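import Mathlib.MeasureTheory.Integral.IntegralEqImproper
import Mathlib.Analysis.Calculus.Deriv.Support
import Mathlib.Analysis.Calculus.ContDiff.Deriv
import HarnessLib

/-!
# Hardy's inequality at infinity on the half-line: `∫₁^∞ f² ≤ 4 ∫₁^∞ x² (f')²`

(namespace `Literature.Analysis.Calculus`)

The one-dimensional Hardy inequality near infinity used throughout the analysis of waves on
black-hole exteriors to recover zeroth-order terms from energy quantities: Dafermos–Rodnianski–
Shlapentokh-Rothman, *Decay for solutions of the wave equation on Kerr exterior spacetimes III*,
arXiv:1402.7034 = Ann. of Math. 183 (2016), §4.3, second display —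
`∫₁^∞ f²(x) dx ≤ C ∫₁^∞ x² (df/dx)² dx` "for functions `f` of compact support" (likewise
Dafermos–Rodnianski, arXiv:1010.5132, §4.3). We **prove** it for `f ∈ C¹(ℝ)` with compact support,
with the explicit constant `C = 4` (`hardy_sq_integral_Ioi_one_le`): with `g = x f²`,
`∫₁^∞ (f² + 2xff') = −f(1)² ≤ 0` (fundamental theorem of calculus on `[1, ∞)`, `g → 0`), and
`−2xff' ≤ ½ f² + 2x² f'²` pointwise, whence `∫ f² ≤ ½ ∫ f² + 2 ∫ x² f'²`.

Not here: the companion logarithmic Hardy inequality near the horizon (loc. cit. §4.3, first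
display, `∫₀² x⁻¹ |log x|⁻² f² ≤ C ∫₀² (f')² + C ∫₁² f²`). Mathlib has no Hardy inequality of
either kind; we use its improper-integral FTC `integral_Ioi_of_hasDerivAt_of_tendsto'` and
integrability of continuous compactly supported functions.

## References

* M. Dafermos, I. Rodnianski, Y. Shlapentokh-Rothman, arXiv:1402.7034 = Ann. of Math. 183 (2016),
  §4.3 (key `DafermosRodnianskiShlapentokhrothman2014`).
* M. Dafermos, I. Rodnianski, arXiv:1010.5132, §4.3 (key `DafermosRodnianski2010KerrSmallA`).
-/

noncomputable section

open MeasureTheory Set Filter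
open scoped Topology

namespace Literature.Analysis.Calculus

/-- A compactly supported function on `ℝ` vanishes eventually at `+∞` (its topological support is
bounded above). [folklore] -/
theorem eventuallyEq_zero_atTop_of_hasCompactSupport {f : ℝ → ℝ} (hf : HasCompactSupport f) :
    f =ᶠ[atTop] 0 := by
  obtain ⟨R, hR⟩ := hf.isCompact.bddAbove
  filter_upwards [eventually_gt_atTop R] with x hx
  exact image_eq_zero_of_notMem_tsupport fun h ↦ (not_le.2 hx) (hR h)

/-- **Hardy's inequality at infinity** (Dafermos–Rodnianski–Shlapentokh-Rothman, arXiv:1402.7034,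
§4.3, second display: `∫₁^∞ f² ≤ C ∫₁^∞ x² (df/dx)²` for `f` of compact support), with `C = 4`:
for `f ∈ C¹(ℝ)` with compact support, `∫_{x > 1} f(x)² dx ≤ 4 ∫_{x > 1} x² f'(x)² dx`.
[cite: DafermosRodnianskiShlapentokhrothman2014, §4.3] -/
theorem hardy_sq_integral_Ioi_one_le {f : ℝ → ℝ} (hf : ContDiff ℝ 1 f)
    (hsupp : HasCompactSupport f) :
    ∫ x in Ioi (1 : ℝ), f x ^ 2 ≤ 4 * ∫ x in Ioi (1 : ℝ), x ^ 2 * deriv f x ^ 2 := by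
  -- regularity and supports
  have hfc : Continuous f := hf.continuous
  have hfd : ∀ x, HasDerivAt f (deriv f x) x := fun x ↦
    ((hf.differentiable (by norm_num)) x).hasDerivAt
  have hf's : HasCompactSupport (deriv f) := hsupp.deriv
  -- the three integrands are continuous with compact support, hence integrable
  have hiA : Integrable (fun x ↦ f x ^ 2) := by
    have hs : HasCompactSupport ((fun t : ℝ ↦ t ^ 2) ∘ f) := hsupp.comp_left (by norm_num)
    exact (hfc.pow 2).integrable_of_hasCompactSupport (μ := volume) hs
  have hf'c : Continuous (deriv f) := hf.continuous_deriv_one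
  have hiI : Integrable (fun x ↦ 2 * x * f x * deriv f x) := by
    have hs : HasCompactSupport ((fun x : ℝ ↦ 2 * x * f x) * deriv f) := hf's.mul_left
    have hc : Continuous ((fun x : ℝ ↦ 2 * x * f x) * deriv f) := by fun_prop
    exact hc.integrable_of_hasCompactSupport (μ := volume) hs
  have hiB : Integrable (fun x ↦ x ^ 2 * deriv f x ^ 2) := by
    have hs : HasCompactSupport ((fun x : ℝ ↦ x ^ 2 * deriv f x) * deriv f) := hf's.mul_left
    have hc : Continuous ((fun x : ℝ ↦ x ^ 2 * deriv f x) * deriv f) := by fun_prop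
    have := hc.integrable_of_hasCompactSupport (μ := volume) hs
    refine this.congr (Eventually.of_forall fun x ↦ ?_)
    simp only [Pi.mul_apply]
    ring
  -- `g = x f²`, `g' = f² + 2 x f f'`, `∫_{x > 1} g' = 0 − g(1)`
  have hg : ∀ x, HasDerivAt (fun x ↦ x * f x ^ 2) (f x ^ 2 + 2 * x * f x * deriv f x) x := by
    intro x
    refine ((hasDerivAt_id x).mul ((hfd x).pow 2)).congr_deriv ?_
    simp
    ring
  have htend : Tendsto (fun x : ℝ ↦ x * f x ^ 2) atTop (𝓝 0) := by
    refine tendsto_const_nhds.congr' ?_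
    filter_upwards [eventuallyEq_zero_atTop_of_hasCompactSupport hsupp] with x hx
    simp [hx]
  have hFTC : ∫ x in Ioi (1 : ℝ), (f x ^ 2 + 2 * x * f x * deriv f x) = 0 - 1 * f 1 ^ 2 :=
    integral_Ioi_of_hasDerivAt_of_tendsto' (fun x _ ↦ hg x) (hiA.add hiI).integrableOn htend
  rw [integral_add hiA.integrableOn hiI.integrableOn] at hFTC
  -- pointwise `−2xff' ≤ ½ f² + 2 x² f'²` since `½ (f + 2xf')² ≥ 0`
  have hpt : ∫ x in Ioi (1 : ℝ), -(2 * x * f x * deriv f x) ≤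
      ∫ x in Ioi (1 : ℝ), (1 / 2 * f x ^ 2 + 2 * (x ^ 2 * deriv f x ^ 2)) := by
    refine integral_mono hiI.neg.integrableOn
      ((hiA.const_mul (1 / 2)).add (hiB.const_mul 2)).integrableOn fun x ↦ ?_
    nlinarith [sq_nonneg (f x + 2 * x * deriv f x)]
  rw [integral_neg, integral_add (hiA.const_mul (1 / 2)).integrableOn (hiB.const_mul 2).integrableOn,
    integral_const_mul, integral_const_mul] at hpt
  nlinarith [sq_nonneg (f 1), hpt, hFTC]

end Literature.Analysis.Calculus

end
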